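import Summits.CriticalPhenomena.PercolationContinuityZ3.Theorems.PercNearOneGluingNoHeavyLowerTailSahiCoordinateAntitone
import Summits.CriticalPhenomena.PercolationContinuityZ3.Theorems.PercNearOneGluingNoHeavyLowerTailSahiTransportJRDict
import Mathlib.Tactic.Linarith
import Mathlib.Tactic.NormNum
import Mathlib.Tactic.FinCases
import HarnessLib

/-!
# `NoHeavyLowerTail` (crux stmt-CriticalPhenomena-4575), master-family line P2: the TWO-THIRDS CONJECTURE (T3∀) and its ANTITONE form
# (MT-k) are FALSE — an explicit seven-coordinate counterexample under the uniform measure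

Support file (seat `prim-masterthm-p2`, gen 13; `--supports stmt-CriticalPhenomena-4575`).  No `sorry`, no named facts, standard axioms.
Memo SAHI-ROUTE.md §4.36.

THE CONJECTURES REFUTED.  `SahiCoordinateTwoThirds.TwoThirds` (gen 11: `3B₂(e) ≥ 2B₃(e)` for the degree-3 Bernstein coefficients of
`s ↦ E_3(μ_{p[e↦s]}; 1_U)` at EVERY coordinate of EVERY increasing triple) and `SahiCoordinateAntitone.MasterAntitone k` (gen 12:
`p ↦ E_k(μ_p; 1_U)/μ_p(⊤)` antitone; `MasterAntitone 3 ⟸ TwoThirds` is the tree's `masterAntitone_three_of_twoThirds`).  Both were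
census-clean (k = 4 exhaustive on fixed parameter grids; adversarial samples for k ≤ 7) and both FAIL on the following CLASS-T triple
(no coordinate is used by all three events), found by an LP relaxation of the single-shared-coordinate case over the nine cell masses
`(A, A′∖A, α∖A′) × (B, B′∖B, β∖B′)`:

  `ι = Fin 7`, coordinates `0 = e` (shared by `A`, `B`), `1 = x`, `2, 3 = y₁, y₂` (block of `A` and `C`), `4 = x′`, `5, 6 = y′₁, y′₂` (block of `B` and `C`);
  `A = {y₁, y₂ ∈ ω ∧ (e ∈ ω ∨ x ∈ ω)}`,  `B = {y′₁, y′₂ ∈ ω ∧ (e ∈ ω ∨ x′ ∈ ω)}`,  `C = {x, y₁, y₂ ∈ ω} ∪ {x′, y′₁, y′₂ ∈ ω} ∪ {x, x′ ∈ ω}`;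
  `p ≡ ½` (uniform) and `p′ = p[e ↦ 1]`.

Counting points of the 7-cube: `|A| = |B| = 24, |C| = 48, |A∩B| = 5, |A∩C| = |B∩C| = 17, |A∩B∩C| = 4` (of 128), so `E_3(μ_p) = 23/2048`; on the face
`e ∈ ω`: `16, 16, 24, 4, 9, 9, 3` (of 64), so `E_3(μ_{p′}) = 3/128`.  (MT-3) demands `E_3(μ_{p′})·∏p ≤ E_3(μ_p)·∏p′`, i.e. `24/2048 ≤ 23/2048` — false.
Equivalently the fibre quadratic at `e` is `q(t) = 2β₁t(1−t) + β₂t²` with `2β₁ = 11/512 < β₂ = 12/512`: `3B₂ − 2B₃ = 2β₁ − β₂ = −1/512`.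
GENERAL FAMILY (paper, memo §4.36): with `y := y₁∧y₂` of probability `s` and `x, x′` of probability `q`, `3B₂ − 2B₃ = −q²s²(1−q)²(1−2s)`, negative
exactly when `s < ½` (at `s = ½` the instance is on the equality locus — which is why parameter grids through `½` missed it).
CONSEQUENCES (memo): also FALSE are (T1) `3B₁ ≥ B₀ + B₃` (same instance: `B₀ = 0`, `ν_C = 0`), the 2-shared form (T3-2sh) and the 'relatively
saturated cap inequality' of SAHI-ROUTE §4.34(i) (the instance is relatively saturated), and `MasterAntitone k` for EVERY `k ≥ 3` (branching
`E_{k+1}(1, U) = (k−1)·E_k(U)`, `not_masterAntitone_add_three`).  NOT affected: Kahn's `C_3` / `MasterFamilyNonneg 3` (the instance is class T, where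
`C_3` is the theorem `SahiTriangleClassT.sahiE_three_nonneg_triangle`), BGC-all (Bernstein-good coordinates; a theorem on class T), the averaged
forms (Σ_e L_e E_3 > 0 here), `DTEGCWeak`, and (T3) at canalyzing coordinates (`…TwoThirdsCases`, `…TwoThirdsImplied`, conjecture SI′).
HONEST FRAMING: two typed conjectures of this programme are settled in the negative by a kernel-checked finite computation; Kahn's Conjecture 5 /
Sahi's `C_3` remain OPEN.  Axioms standard. [this work]
-/

noncomputable section

open scoped Classical

namespace Summit.CriticalPhenomena.PercolationContinuityZ3.Theorems

namespace SahiCoordinateTwoThirdsFalse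

open Finset Literature.Combinatorics.Sahi2008
open Literature.Probability.Percolation.DecisionTree (ind ind_of_mem ind_of_not_mem)
open SahiCoordinateTwoThirds (TwoThirds)
open SahiCoordinateAntitone (MasterAntitone masterAntitone_three_of_twoThirds)
open SahiC3Cube (pt)
open Literature.Probability.Percolation (half coe_half)

/-! ### 1. The instance -/

/-- `A = {y₁, y₂ ∈ ω ∧ (e ∈ ω ∨ x ∈ ω)}` on `Fin 7` (`e = 0`, `x = 1`, `y₁ = 2`, `y₂ = 3`). [this work] -/
def cexA : Set (Set (Fin 7)) := {ω | (2 : Fin 7) ∈ ω ∧ (3 : Fin 7) ∈ ω ∧ ((0 : Fin 7) ∈ ω ∨ (1 : Fin 7) ∈ ω)}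

/-- `B = {y′₁, y′₂ ∈ ω ∧ (e ∈ ω ∨ x′ ∈ ω)}` (`x′ = 4`, `y′₁ = 5`, `y′₂ = 6`). [this work] -/
def cexB : Set (Set (Fin 7)) := {ω | (5 : Fin 7) ∈ ω ∧ (6 : Fin 7) ∈ ω ∧ ((0 : Fin 7) ∈ ω ∨ (4 : Fin 7) ∈ ω)}

/-- `C = {x, y₁, y₂ ∈ ω} ∪ {x′, y′₁, y′₂ ∈ ω} ∪ {x, x′ ∈ ω}` (free of `e`). [this work] -/
def cexC : Set (Set (Fin 7)) :=
  {ω | ((1 : Fin 7) ∈ ω ∧ (2 : Fin 7) ∈ ω ∧ (3 : Fin 7) ∈ ω) ∨ ((4 : Fin 7) ∈ ω ∧ (5 : Fin 7) ∈ ω ∧ (6 : Fin 7) ∈ ω) ∨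
    ((1 : Fin 7) ∈ ω ∧ (4 : Fin 7) ∈ ω)}

/-- The triple `U = (A, B, C)`. [this work] -/
def cexU : Fin 3 → Set (Set (Fin 7)) := ![cexA, cexB, cexC]

/-- The uniform parameter vector `p ≡ ½` (`half` is the tree's `Literature.Probability.Percolation.half`). [this work] -/
def pHalf : Fin 7 → unitInterval := fun _ => half

/-- The larger parameter vector `p′ = p[e ↦ 1]`. [this work] -/
def pTop : Fin 7 → unitInterval := fun i => if i = 0 then 1 else half

/-- Bits of `A`: membership of the coded point `pt 7 j` (`mem_cexA`). [this work] -/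
def bA (j : ℕ) : Bool := j.testBit 2 && j.testBit 3 && (j.testBit 0 || j.testBit 1)

/-- Bits of `B`. [this work] -/
def bB (j : ℕ) : Bool := j.testBit 5 && j.testBit 6 && (j.testBit 0 || j.testBit 4)

/-- Bits of `C`. [this work] -/
def bC (j : ℕ) : Bool :=
  (j.testBit 1 && j.testBit 2 && j.testBit 3) || (j.testBit 4 && j.testBit 5 && j.testBit 6) || (j.testBit 1 && j.testBit 4)

/-- `A` is an up-set. [this work] -/
theorem isUpperSet_cexA : IsUpperSet cexA := by
  intro ω ω' hle hω
  exact ⟨hle hω.1, hle hω.2.1, hω.2.2.imp (fun h => hle h) (fun h => hle h)⟩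

/-- `B` is an up-set. [this work] -/
theorem isUpperSet_cexB : IsUpperSet cexB := by
  intro ω ω' hle hω
  exact ⟨hle hω.1, hle hω.2.1, hω.2.2.imp (fun h => hle h) (fun h => hle h)⟩

/-- `C` is an up-set. [this work] -/
theorem isUpperSet_cexC : IsUpperSet cexC := by
  intro ω ω' hle hω
  rcases hω with h | h | h
  · exact Or.inl ⟨hle h.1, hle h.2.1, hle h.2.2⟩
  · exact Or.inr (Or.inl ⟨hle h.1, hle h.2.1, hle h.2.2⟩)
  · exact Or.inr (Or.inr ⟨hle h.1, hle h.2⟩)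

/-- All three events are up-sets. [this work] -/
theorem isUpperSet_cexU : ∀ j, IsUpperSet (cexU j) := by
  intro j; fin_cases j
  · exact isUpperSet_cexA
  · exact isUpperSet_cexB
  · exact isUpperSet_cexC

/-- `p ≤ p′` coordinatewise. [this work] -/
theorem pHalf_le_pTop : ∀ e, pHalf e ≤ pTop e := by
  intro e
  by_cases he : e = 0
  · simp only [pHalf, pTop, he, if_true]; exact unitInterval.le_one'
  · simp only [pHalf, pTop, he, if_false]; exact le_rfl

/-! ### 2. The two product weights and their expectations as sums over the 128 codes -/

/-- Under `p ≡ ½` every configuration has weight `1/128`. [this work] -/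
theorem weight_pHalf (ω : Set (Fin 7)) : bernoulliWeight pHalf ω = 1 / 128 := by
  show (∏ e : Fin 7, if e ∈ ω then ((pHalf e : unitInterval) : ℝ) else 1 - ((pHalf e : unitInterval) : ℝ)) = 1 / 128
  have h : ∀ e : Fin 7, (if e ∈ ω then ((pHalf e : unitInterval) : ℝ) else 1 - ((pHalf e : unitInterval) : ℝ)) = 1 / 2 := by
    intro e; simp only [pHalf, coe_half]; split_ifs <;> norm_num
  rw [Finset.prod_congr rfl fun e _ => h e, Finset.prod_const, Finset.card_univ, Fintype.card_fin]
  norm_num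

/-- Under `p′` the weight is `1/64` on the face `e ∈ ω` and `0` off it. [this work] -/
theorem weight_pTop (ω : Set (Fin 7)) : bernoulliWeight pTop ω = if (0 : Fin 7) ∈ ω then 1 / 64 else 0 := by
  show (∏ e : Fin 7, if e ∈ ω then ((pTop e : unitInterval) : ℝ) else 1 - ((pTop e : unitInterval) : ℝ)) = _
  rw [← Finset.mul_prod_erase Finset.univ _ (Finset.mem_univ (0 : Fin 7))]
  have h : ∀ e ∈ Finset.univ.erase (0 : Fin 7),
      (if e ∈ ω then ((pTop e : unitInterval) : ℝ) else 1 - ((pTop e : unitInterval) : ℝ)) = 1 / 2 := by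
    intro e he
    have hne : e ≠ 0 := Finset.ne_of_mem_erase he
    simp only [pTop, hne, if_false, coe_half]; split_ifs <;> norm_num
  rw [Finset.prod_congr rfl h, Finset.prod_const, Finset.card_erase_of_mem (Finset.mem_univ _), Finset.card_univ,
    Fintype.card_fin]
  simp only [pTop, if_true, Set.Icc.coe_one]
  split_ifs <;> norm_num

/-- Expectation under `p ≡ ½` as a sum over the codes `j < 128` of the points `pt 7 j`. [this work] -/
theorem ex_pHalf (F : Set (Fin 7) → ℝ) :
    ex (bernoulliWeight pHalf) F = (1 / 128) * ∑ j ∈ Finset.range 128, F (pt 7 j) := by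
  rw [ex_def]
  have h1 : (∑ x : Set (Fin 7), bernoulliWeight pHalf x * F x) = ∑ x : Set (Fin 7), (1 / 128) * F x :=
    Finset.sum_congr rfl fun x _ => by rw [weight_pHalf]
  rw [h1, SahiTransportJR.sum_eq_sum_range (m := 7) (fun x => (1 / 128 : ℝ) * F x), ← Finset.mul_sum]
  norm_num

/-- `e ∈ pt 7 j ↔` bit `0` of `j` is set. [this work] -/
theorem zero_mem_pt (j : ℕ) : (0 : Fin 7) ∈ pt 7 j ↔ j.testBit 0 = true := Iff.rfl

/-- Expectation under `p′` as a sum over the codes with bit `0` set. [this work] -/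
theorem ex_pTop (F : Set (Fin 7) → ℝ) :
    ex (bernoulliWeight pTop) F = (1 / 64) * ∑ j ∈ Finset.range 128, (if j.testBit 0 = true then F (pt 7 j) else 0) := by
  rw [ex_def]
  have h1 : (∑ x : Set (Fin 7), bernoulliWeight pTop x * F x) =
      ∑ x : Set (Fin 7), (1 / 64) * (if (0 : Fin 7) ∈ x then F x else 0) :=
    Finset.sum_congr rfl fun x _ => by rw [weight_pTop]; split_ifs <;> ring
  rw [h1, SahiTransportJR.sum_eq_sum_range (m := 7) (fun x => (1 / 64 : ℝ) * (if (0 : Fin 7) ∈ x then F x else 0)),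
    ← Finset.mul_sum]
  norm_num [zero_mem_pt]

/-! ### 3. Membership of the coded points: Boolean predicates and the seven counts -/

/-- Membership of a coded point in `A`. [this work] -/
theorem mem_cexA (j : ℕ) : pt 7 j ∈ cexA ↔ bA j = true := by
  simp [cexA, pt, bA, and_assoc]

/-- Membership of a coded point in `B`. [this work] -/
theorem mem_cexB (j : ℕ) : pt 7 j ∈ cexB ↔ bB j = true := by
  simp [cexB, pt, bB, and_assoc]

/-- Membership of a coded point in `C`. [this work] -/
theorem mem_cexC (j : ℕ) : pt 7 j ∈ cexC ↔ bC j = true := by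
  simp [cexC, pt, bC, and_assoc, or_assoc]

/-- Indicator as a Boolean `ite`. [folklore] -/
theorem ind_eq_ite {α : Type*} (X : Set α) (ω : α) (b : Bool) (h : ω ∈ X ↔ b = true) :
    ind X ω = if b = true then 1 else 0 := by
  by_cases hb : b = true
  · rw [if_pos hb, ind_of_mem (h.2 hb)]
  · rw [if_neg hb, ind_of_not_mem fun hω => hb (h.1 hω)]

/-- `(𝟙_a)(𝟙_b) = 𝟙_{a ∧ b}` for Boolean `ite`s. [folklore] -/
theorem ite_mul_ite (a b : Bool) :
    ((if a = true then (1 : ℝ) else 0) * (if b = true then 1 else 0)) = if (a && b) = true then 1 else 0 := by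
  cases a <;> cases b <;> simp

/-- The product of the three indicators on a coded point. [this work] -/
theorem ind3_pt (j : ℕ) :
    (ind cexA * ind cexB * ind cexC) (pt 7 j) = if (bA j && bB j && bC j) = true then 1 else 0 := by
  simp only [Pi.mul_apply, ind_eq_ite _ _ _ (mem_cexA j), ind_eq_ite _ _ _ (mem_cexB j), ind_eq_ite _ _ _ (mem_cexC j),
    ite_mul_ite]

/-- Product of two indicators on a coded point (`A`, `B`). [this work] -/
theorem indAB_pt (j : ℕ) : (ind cexA * ind cexB) (pt 7 j) = if (bA j && bB j) = true then 1 else 0 := by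
  simp only [Pi.mul_apply, ind_eq_ite _ _ _ (mem_cexA j), ind_eq_ite _ _ _ (mem_cexB j), ite_mul_ite]

/-- Product of two indicators on a coded point (`A`, `C`). [this work] -/
theorem indAC_pt (j : ℕ) : (ind cexA * ind cexC) (pt 7 j) = if (bA j && bC j) = true then 1 else 0 := by
  simp only [Pi.mul_apply, ind_eq_ite _ _ _ (mem_cexA j), ind_eq_ite _ _ _ (mem_cexC j), ite_mul_ite]

/-- Product of two indicators on a coded point (`B`, `C`). [this work] -/
theorem indBC_pt (j : ℕ) : (ind cexB * ind cexC) (pt 7 j) = if (bB j && bC j) = true then 1 else 0 := by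
  simp only [Pi.mul_apply, ind_eq_ite _ _ _ (mem_cexB j), ind_eq_ite _ _ _ (mem_cexC j), ite_mul_ite]

/-- The fourteen counts (kernel computation over `j < 128`). [this work] -/
theorem counts :
    (#{j ∈ Finset.range 128 | bA j = true} = 24 ∧ #{j ∈ Finset.range 128 | bB j = true} = 24 ∧
      #{j ∈ Finset.range 128 | bC j = true} = 48 ∧ #{j ∈ Finset.range 128 | (bA j && bB j) = true} = 5 ∧
      #{j ∈ Finset.range 128 | (bA j && bC j) = true} = 17 ∧ #{j ∈ Finset.range 128 | (bB j && bC j) = true} = 17 ∧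
      #{j ∈ Finset.range 128 | (bA j && bB j && bC j) = true} = 4) ∧
    (#{j ∈ Finset.range 128 | (j.testBit 0 && bA j) = true} = 16 ∧ #{j ∈ Finset.range 128 | (j.testBit 0 && bB j) = true} = 16 ∧
      #{j ∈ Finset.range 128 | (j.testBit 0 && bC j) = true} = 24 ∧ #{j ∈ Finset.range 128 | (j.testBit 0 && (bA j && bB j)) = true} = 4 ∧
      #{j ∈ Finset.range 128 | (j.testBit 0 && (bA j && bC j)) = true} = 9 ∧
      #{j ∈ Finset.range 128 | (j.testBit 0 && (bB j && bC j)) = true} = 9 ∧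
      #{j ∈ Finset.range 128 | (j.testBit 0 && (bA j && bB j && bC j)) = true} = 3) := by
  decide

/-! ### 4. The two values of `E_3` -/

/-- The family of indicators of `U` as a triple. [this work] -/
theorem ind_cexU : (fun j => ind (cexU j)) = ![ind cexA, ind cexB, ind cexC] := by
  funext j; fin_cases j <;> rfl

/-- Folding `if t then (if b then x else 0) else 0`. [folklore] -/
theorem ite_ite_eq (t b : Bool) (x : ℝ) :
    (if t = true then (if b = true then x else 0) else 0) = if (t && b) = true then x else 0 := by
  cases t <;> cases b <;> simp

/-- **`E_3(μ_{½}; A, B, C) = 23/2048`.** [this work] -/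
theorem sahiE_three_pHalf : sahiE (bernoulliWeight pHalf) 3 (fun j => ind (cexU j)) = 23 / 2048 := by
  rw [ind_cexU, sahiE_three]
  simp only [ex_pHalf, ind3_pt, indAB_pt, indAC_pt, indBC_pt, ind_eq_ite _ _ _ (mem_cexA _), ind_eq_ite _ _ _ (mem_cexB _),
    ind_eq_ite _ _ _ (mem_cexC _), Finset.sum_boole]
  obtain ⟨⟨h1, h2, h3, h4, h5, h6, h7⟩, -⟩ := counts
  rw [h1, h2, h3, h4, h5, h6, h7]
  norm_num

/-- **`E_3(μ_{p′}; A, B, C) = 3/128`** (`p′ = p[e ↦ 1]`). [this work] -/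
theorem sahiE_three_pTop : sahiE (bernoulliWeight pTop) 3 (fun j => ind (cexU j)) = 3 / 128 := by
  rw [ind_cexU, sahiE_three]
  simp only [ex_pTop, ind3_pt, indAB_pt, indAC_pt, indBC_pt, ind_eq_ite _ _ _ (mem_cexA _), ind_eq_ite _ _ _ (mem_cexB _),
    ind_eq_ite _ _ _ (mem_cexC _), ite_ite_eq, Finset.sum_boole]
  obtain ⟨-, h1, h2, h3, h4, h5, h6, h7⟩ := counts
  rw [h1, h2, h3, h4, h5, h6, h7]
  norm_num

/-- `∏ p = 1/128`. [this work] -/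
theorem prod_pHalf : ∏ e, ((pHalf e : unitInterval) : ℝ) = 1 / 128 := by
  simp only [pHalf, coe_half, Finset.prod_const, Finset.card_univ, Fintype.card_fin]; norm_num

/-- `∏ p′ = 1/64`. [this work] -/
theorem prod_pTop : ∏ e, ((pTop e : unitInterval) : ℝ) = 1 / 64 := by
  rw [← Finset.mul_prod_erase Finset.univ _ (Finset.mem_univ (0 : Fin 7))]
  have h : ∀ e ∈ Finset.univ.erase (0 : Fin 7), ((pTop e : unitInterval) : ℝ) = 1 / 2 := by
    intro e he
    have hne : e ≠ 0 := Finset.ne_of_mem_erase he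
    simp only [pTop, hne, if_false, coe_half]
  rw [Finset.prod_congr rfl h, Finset.prod_const, Finset.card_erase_of_mem (Finset.mem_univ _), Finset.card_univ,
    Fintype.card_fin]
  simp only [pTop, if_true, Set.Icc.coe_one]
  norm_num

/-! ### 5. The refutations -/

/-- **(MT-3) IS FALSE**: `E_3(μ_{p′})·∏p = 3/16384 > E_3(μ_p)·∏p′ = 23/131072` for the instance above. [this work] -/
theorem not_masterAntitone_three : ¬ MasterAntitone 3 := by
  intro h
  have h1 := h (Fin 7) pHalf pTop cexU isUpperSet_cexU pHalf_le_pTop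
  rw [sahiE_three_pHalf, sahiE_three_pTop, prod_pHalf, prod_pTop] at h1
  norm_num at h1

/-- **(T3∀) IS FALSE** (`3B₂(e) − 2B₃(e) = −1/512` at the shared coordinate `e` of the instance; formally via the tree's reduction
`TwoThirds → MasterAntitone 3`). [this work] -/
theorem not_twoThirds : ¬ TwoThirds := fun h => not_masterAntitone_three (masterAntitone_three_of_twoThirds h)

/-- The hierarchy step of the antitone form: `MasterAntitone (n+3) → MasterAntitone (n+2)` (pad the family with the sure event and use
the branching identity `E_{n+3}(1, U) = (n+1)·E_{n+2}(U)`). [this work] -/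
theorem masterAntitone_of_succ (n : ℕ) (h : MasterAntitone (n + 3)) : MasterAntitone (n + 2) := by
  intro ι _ p p' U hU hle
  have hup : ∀ j, IsUpperSet ((Matrix.vecCons (Set.univ : Set (Set ι)) U : Fin (n + 3) → Set (Set ι)) j) := by
    intro j
    refine Fin.cases ?_ (fun i => ?_) j
    · exact isUpperSet_univ
    · simpa using hU i
  have key := h ι p p' (Matrix.vecCons Set.univ U) hup hle
  have hind : (fun j => ind ((Matrix.vecCons (Set.univ : Set (Set ι)) U : Fin (n + 3) → Set (Set ι)) j)) =
      Matrix.vecCons (1 : Set ι → ℝ) (fun j => ind (U j)) := by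
    funext j
    refine Fin.cases ?_ (fun i => ?_) j
    · simp only [Matrix.cons_val_zero]
      funext ω; exact ind_of_mem (Set.mem_univ ω)
    · simp only [Matrix.cons_val_succ]
  rw [hind, sahiE_one_cons (sum_bernoulliWeight p') (n + 1), sahiE_one_cons (sum_bernoulliWeight p) (n + 1)] at key
  have hn : (0 : ℝ) < (n + 1 : ℕ) := by exact_mod_cast Nat.succ_pos n
  have key' : ((n + 1 : ℕ) : ℝ) * (sahiE (bernoulliWeight p') (n + 2) (fun j => ind (U j)) * ∏ e, (p e : ℝ)) ≤
      ((n + 1 : ℕ) : ℝ) * (sahiE (bernoulliWeight p) (n + 2) (fun j => ind (U j)) * ∏ e, (p' e : ℝ)) := by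
    have e1 : ((n + 1 : ℕ) : ℝ) = (↑(n + 1) : ℝ) := rfl
    nlinarith [key]
  exact le_of_mul_le_mul_left key' hn

/-- **(MT-k) IS FALSE FOR EVERY `k ≥ 3`.** [this work] -/
theorem not_masterAntitone_add_three (n : ℕ) : ¬ MasterAntitone (n + 3) := by
  induction n with
  | zero => exact not_masterAntitone_three
  | succ n ih => exact fun h => ih (masterAntitone_of_succ (n + 1) h)

end SahiCoordinateTwoThirdsFalse

end Summit.CriticalPhenomena.PercolationContinuityZ3.Theorems
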